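import Summits.QuantumFields.YangMills.Theorems.UnitScaleTiltProp7SectET3JcurReality
import HarnessLib

/-!
# Route `UnitScaleTilt`, crux K1 child «MinimiserStabilityRegPr» (stmt-QuantumFields-19200), stub `stub_existenceMinimalOrbit` (EX), route (α) — (R-V₀) «V0-CURRENT-REALITY», FILE V1:
# **THE `SU(2)` 2 × 2 LETTERS** behind the central-line vanishing and the reality of the V₀-group current's bond functionals
# (LOCATE `ym3-torus-px3/g3/LOCATE-RV0-px3g3.md` §3, facts F0 and F6)

Cell `ym3-torus`, width seat `ym3-torus-px3` (gen 3; EX display S13ᴰ ✓p682315 row `hV0`).  THEOREMS ONLY (0 `def`, 0 `sorry`); `--supports stmt-QuantumFields-19200 --as helper`; count-neutral.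
YM₃ on T³ is a ladder rung (R3), NOT the Clay problem; nothing here claims the stub, the crux, d = 4 or the mass gap.

THE PRINT.  [Balaban1985BackgroundPropagators] p. 391 (`Re V = ½(V + V⁻¹)`, `Im V = (2i)⁻¹(V − V⁻¹)` on the group), (3.1) p. 390; [Balaban1985Variational] (29)–(30) p. 282, (39) p. 284, (63) p. 287, (90)
p. 291 (the bond derivatives of `V₀′(A, ∂p)`), (51) p. 286.  For `G = SU(2)`: `W⁻¹ = (tr W)·1 − W` (Cayley–Hamilton at `det W = 1`), so `Re W = ½(tr W)·1` is CENTRAL and `tr Im W = 0`.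

WHAT IS PROVED (sorry-free, no definition; [folklore]).
* §1 ★`star_eq_trace_smul_one_sub` (`W ∈ SU(2) ⟹ Wᴴ = (tr W)•1 − W`), ★`reC_eq_half_trace_smul_one` (`Re W = ½(tr W)•1` for a unit of `M₂(ℂ)` with `SU(2)` value), ★`trace_imC_eq_zero`
  (`tr Im W = 0`), `trace_mul_reC_eq_zero_of_trace_zero` (`tr(X·Re W) = 0` for traceless `X`) — lit's `B9Eq37Insertion.reC ∕ imC` letters.
* (F6) «real on the real axis ⟹ real derivative» is ✓`Literature.Analysis.SpecialFunctions.im_deriv_eq_zero_of_real` BY NAME (dedup caught at dry-run; not restated here).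
HONEST SCOPE.  Algebra and one-variable calculus; nothing of [Balaban1985Variational] asserted; the row `hV0` is NOT closed here (files V2–V3 of the LOCATE).

References: T. Bałaban, CMP **99** (1985) 389–434 [Balaban1985BackgroundPropagators] (p.391, (3.1) p.390); CMP **102** (1985) 277–309 [Balaban1985Variational] ((29)–(30) p.282, (39) p.284,
(63) p.287, (90) p.291, (51) p.286).
-/

set_option autoImplicit false

noncomputable section

open scoped Matrix.Norms.L2Operator BigOperators

namespace Summit.QuantumFields.YangMills.Theorems.Prop7V0CurrentSU2Letters

open Literature.MathematicalPhysics.QuantumFieldTheory.Balaban1983to89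
open B9Eq37Insertion (reC imC)
open Summit.QuantumFields.YangMills.Theorems.Prop7SectET3JcurReality (val_inv_eq_star_of_mem_su2)

/-! ## §1 `SU(2)`: `Wᴴ = (tr W)•1 − W`, `Re W = ½(tr W)•1`, `tr Im W = 0` -/

/-- ★ **CAYLEY–HAMILTON AT `det = 1`: `Wᴴ = (tr W)•1 − W` for `W ∈ SU(2)`** (`Wᴴ = W⁻¹ = adj W`). [folklore] -/
theorem star_eq_trace_smul_one_sub {W : Matrix (Fin 2) (Fin 2) ℂ} (hW : W ∈ Matrix.specialUnitaryGroup (Fin 2) ℂ) :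
    star W = W.trace • (1 : Matrix (Fin 2) (Fin 2) ℂ) - W := by
  obtain ⟨hU, hdet⟩ := Matrix.mem_specialUnitaryGroup_iff.1 hW
  have h1 : star W * W = 1 := Matrix.mem_unitaryGroup_iff'.1 hU
  -- `Wᴴ = W⁻¹ = det⁻¹ • adj W = adj W`
  have hinv : W⁻¹ = star W := Matrix.inv_eq_left_inv h1
  have hadj : W⁻¹ = W.adjugate := by rw [Matrix.inv_def, hdet, Ring.inverse_one, one_smul]
  rw [← hinv, hadj, Matrix.adjugate_fin_two, Matrix.trace_fin_two]
  ext i j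
  fin_cases i <;> fin_cases j <;> simp

/-- ★ **`Re W = ½(tr W)•1` FOR A UNIT OF `M₂(ℂ)` WITH `SU(2)` VALUE** (lit's `reC W = ½(W + W⁻¹)`): the real part is CENTRAL. [cite: Balaban1985BackgroundPropagators, p.391] -/
theorem reC_eq_half_trace_smul_one {W : (Matrix (Fin 2) (Fin 2) ℂ)ˣ} (hW : (W : Matrix (Fin 2) (Fin 2) ℂ) ∈ Matrix.specialUnitaryGroup (Fin 2) ℂ) :
    reC W = ((2 : ℂ)⁻¹ * (W : Matrix (Fin 2) (Fin 2) ℂ).trace) • (1 : Matrix (Fin 2) (Fin 2) ℂ) := by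
  rw [reC, val_inv_eq_star_of_mem_su2 hW, star_eq_trace_smul_one_sub hW, add_sub_cancel, smul_smul]

/-- ★ **`tr Im W = 0` FOR A UNIT OF `M₂(ℂ)` WITH `SU(2)` VALUE** (lit's `imC W = (2i)⁻¹(W − W⁻¹)`; `tr(Wᴴ) = 2tr W − tr W`). [cite: Balaban1985BackgroundPropagators, p.391, (3.11) p.392] -/
theorem trace_imC_eq_zero {W : (Matrix (Fin 2) (Fin 2) ℂ)ˣ} (hW : (W : Matrix (Fin 2) (Fin 2) ℂ) ∈ Matrix.specialUnitaryGroup (Fin 2) ℂ) :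
    (imC W).trace = 0 := by
  rw [imC, val_inv_eq_star_of_mem_su2 hW, star_eq_trace_smul_one_sub hW, Matrix.trace_smul, Matrix.trace_sub, Matrix.trace_sub, Matrix.trace_smul,
    Matrix.trace_one, Fintype.card_fin, smul_eq_mul, smul_eq_mul]
  push_cast
  ring

/-- `tr(X·Re W) = 0` for traceless `X` and `W ∈ SU(2)` (`Re W` is central). [cite: Balaban1985BackgroundPropagators, p.391] -/
theorem trace_mul_reC_eq_zero_of_trace_zero {W : (Matrix (Fin 2) (Fin 2) ℂ)ˣ} (hW : (W : Matrix (Fin 2) (Fin 2) ℂ) ∈ Matrix.specialUnitaryGroup (Fin 2) ℂ)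
    {X : Matrix (Fin 2) (Fin 2) ℂ} (hX : X.trace = 0) : (X * reC W).trace = 0 := by
  rw [reC_eq_half_trace_smul_one hW, Matrix.mul_smul, Matrix.mul_one, Matrix.trace_smul, hX, smul_zero]

/-- `tr(Re W·X) = 0` likewise. [cite: Balaban1985BackgroundPropagators, p.391] -/
theorem trace_reC_mul_eq_zero_of_trace_zero {W : (Matrix (Fin 2) (Fin 2) ℂ)ˣ} (hW : (W : Matrix (Fin 2) (Fin 2) ℂ) ∈ Matrix.specialUnitaryGroup (Fin 2) ℂ)
    {X : Matrix (Fin 2) (Fin 2) ℂ} (hX : X.trace = 0) : (reC W * X).trace = 0 := by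
  rw [Matrix.trace_mul_comm, trace_mul_reC_eq_zero_of_trace_zero hW hX]

/-! (F6) — «real on the real axis ⟹ real derivative» — is ALREADY in the tree: ✓`Literature.Analysis.SpecialFunctions.im_deriv_eq_zero_of_real` (dedup caught at dry-run; not restated). -/

end Summit.QuantumFields.YangMills.Theorems.Prop7V0CurrentSU2Letters

end
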